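import Summits.Ventures.PercRepro.HyperplaneKeyUpwardRowsA
import Summits.Ventures.PercRepro.HyperplaneKeyWindowTails

/-!
# PercRepro — THE FIRST ROW OF THE LEVEL-`7` WINDOW, `p = 9`, BY THE UPWARD KEY: `c025_core_seven_upward_9` (`n ≥ 88`), AND THE
WINDOW-TAIL DISPATCH FROM `p = 9` (p1, gen 45; an S4 feeder — p9 owns SUBCLAIM-S4; no window claim here)

The level-`7` window of record is `9 ≤ p ≤ 104` (ADDENDUM 67), but the row theorems of the tails started at `p = 10`
(`HyperplaneKeyUpwardRowsA`, `HyperplaneKeyWindowTails`); the formula theorem `c025_core_seven_upward_key` covers `p = 9` as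
soon as `8·Φ(9, 7) = 9 ≤ n − 79`. Here: **`RLS M 9 7` for every `e`-free `M` on `n ≥ 88` points** (`c025_core_seven_upward_9`,
no rank hypothesis; `d ≥ 79`), and the dispatch **`c025_core_seven_window_tail'`: `9 ≤ p ≤ 104`, `ρ(E) = p`, `n ≥ 202`
give `RLS M p 7`** (the row `9` from `88 ≤ 202`, the rows `10 … 104` as before). Coloops are not excluded; nothing is
claimed below the thresholds. Axioms: standard.
-/

open scoped Matroid

namespace PercRepro

namespace HypKey

open Set

variable {α : Type}

/-- **Row `p = 9` at level `7` by the upward key**: `RLS M 9 7` for every `e`-free `M` on `n ≥ 88` points (one layer: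
`8·Φ(9, 7) = 9 ≤ n − 79`). -/
theorem c025_core_seven_upward_9 (M : Matroid α) [M.Finite] (hn : 88 ≤ M.E.ncard)
    (hfree : ∀ e ∈ M.E, ∃ A ⊆ M.E \ {e}, e ∉ M.closure A ∧ e ∉ M.closure ((M.E \ {e}) \ A)) :
    ThmN.RLS M 9 7 :=
  c025_core_seven_upward_key M 9 (by norm_num) (by omega)
    (by
      have hn' : (88 : ℚ) ≤ (M.E.ncard : ℚ) := by exact_mod_cast hn
      rw [phiK_eq_two_pow_sub 9 7 (by norm_num), Nat.choose_symm_add]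
      simp only [Finset.sum_range_succ, Finset.sum_range_zero]
      norm_num [Nat.choose_eq_descFactorial_div_factorial, Nat.descFactorial_succ, Nat.descFactorial_zero, Nat.factorial]
      linarith)
    hfree

/-- **The level-`7` window's tail from its first row**: `e`-free, `ρ(E) = p` with `9 ≤ p ≤ 104`, `n ≥ 202` give `RLS M p 7`
(row `9` by `c025_core_seven_upward_9`, rows `10 … 104` by `c025_core_seven_window_tail`). -/
theorem c025_core_seven_window_tail' (M : Matroid α) [M.Finite] (p : ℕ) (hp : 9 ≤ p) (hp' : p ≤ 104)
    (hR : M.eRank = (p : ℕ∞)) (hn : 202 ≤ M.E.ncard)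
    (hfree : ∀ e ∈ M.E, ∃ A ⊆ M.E \ {e}, e ∉ M.closure A ∧ e ∉ M.closure ((M.E \ {e}) \ A)) :
    ThmN.RLS M p 7 := by
  rcases Nat.eq_or_lt_of_le hp with h9 | h10
  · subst h9
    exact c025_core_seven_upward_9 M (by omega) hfree
  · exact c025_core_seven_window_tail M p h10 hp' hR hn hfree

end HypKey

end PercRepro
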